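import Summits.CriticalPhenomena.PercolationContinuityZ3.Theorems.Transplant.PyrochloreNegCyl
import Summits.CriticalPhenomena.PercolationContinuityZ3.Theorems.Transplant.InducedSkeletonSign
import Summits.CriticalPhenomena.PercolationContinuityZ3.Theorems.Transplant.PlanarSkeletonFrmRayHolds
import HarnessLib

/-!
# Pyrochlore-bond, IV — THE TWO-TYPE `{±1}` SKELETON, TYPED: ambient `{±1}` data make `G[S]` a `PlanarSkeletonNeg` (`InducedNegData.skeleton`), and
# the pyrochlore site graph `PyroZ3.graph[sites]` carries one with exactly TWO base vertices (`PyroZ3.skeletonNeg₂`); `θ = 0` at its own `p_c` modulo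
# the OPEN multi-type `{±1}` node u2 (`SamePDropOfSkeletonNeg`) — the customer's ticket, nothing claimed about the node

builds on p205010 (kernel theorem, internal audit signed; external expert review pending) — nothing in this file uses p205010; the percolation
conclusion is CONDITIONAL on the OPEN node `SamePDropOfSkeletonNeg` (hypothesis `hD`).  Lane `prim-bschramm`, seat `prim-bschramm-p4` (gen 21; PART
C3, `HOME/bschramm/P4-GENERAL.md` §43.2b).  Helper file (`--supports stmt-CriticalPhenomena-4575 --as helper`).  Prequels: `PyrochloreNegChart`
(`uchart`, `ulip`, `ustep`, `exists_uneg_site`, `exists_frame₂`, `degree_le_twelve`), `PyrochloreNegCyl` (`ucyl_connected`); pattern of p2-g12's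
`InducedSignData` (`InducedSkeletonSign`) without the axis flip and without finiteness of cylinders.
* §1 `InducedNegData G S` (chart 1-Lipschitz on `G`, degree bound, base vertices `T ⊆ S`, `S`-preserving translating frames and central inversions,
  unit steps inside `S`, CONNECTED relative cylinders) ⟹ **`InducedNegData.skeleton : PlanarSkeletonNeg (G.induce S)`**,
  `criticalContinuity_of_negNode` (mod u2, every vertex of `S`, Φ2-free by `PlanarSkeletonNeg.criticalContinuity_of_negNode`);
* §2 **`PyroZ3.negData : InducedNegData PyroZ3.graph PyroZ3.sites`**, `negData_T_card : T.card = 2`, **`PyroZ3.skeletonNeg₂ : PlanarSkeletonNeg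
  (PyroZ3.graph.induce PyroZ3.sites)`**, **`PyroZ3.criticalContinuity_of_negNode : SamePDropOfSkeletonNeg → ∀ v, θ_v(p_c(pyrochlore)) = 0`**.
[cite: KozmaNitzan2024, §4 pp. 15–17 (boxes; Lemma 8)] [cite: BenjaminiSchramm1996, Conj. 4] [cite: ConwaySloane1999, Ch. 4 §6.1]
-/

noncomputable section

namespace Summit.CriticalPhenomena.PercolationContinuityZ3.Theorems.Transplant

open SimpleGraph Literature.Probability.LatticeModels Literature.Probability.Percolation
open Literature.Barriers.CriticalPhenomena (countable_of_connected_of_locallyFinite)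
open scoped Classical

/-! ## §1 Ambient `{±1}` data and the induced `PlanarSkeletonNeg` -/

/-- **Ambient `{±1}` data for an induced subgraph `G[S]`**: a chart `φ : V → ℤ²` 1-Lipschitz along `G`, a degree bound, base vertices `T ⊆ S`,
`S`-preserving automorphisms of `G` as translating frames and as central inversion at each base vertex, unit chart steps inside `S`, and CONNECTED
relative cylinders `{w ∈ S : φ w − φ t ∈ Λ_ℓ}` (`ℓ ≥ 1`).  (No axis flip, no finiteness: the `{±1}` analogue of `InducedSignData`.)
[cite: KozmaNitzan2024, §4 pp. 15–17] -/
structure InducedNegData {V : Type} (G : SimpleGraph V) [G.LocallyFinite] (S : Set V) where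
  /-- the chart -/
  φ : V → Site 2
  /-- the chart is 1-Lipschitz along edges of `G` -/
  lip : ∀ ⦃u v : V⦄, G.Adj u v → ∀ i : Fin 2, |φ u i - φ v i| ≤ 1
  /-- a degree bound for `G` -/
  Δ : ℕ
  /-- every vertex of `G` has degree `≤ Δ` -/
  degree_le : ∀ v : V, G.degree v ≤ Δ
  /-- the base vertices -/
  T : Finset S
  /-- FRAMES inside `S` -/
  frame : ∀ v : S, ∃ t ∈ T, ∃ α : G ≃g G, (∀ w, w ∈ S ↔ α w ∈ S) ∧ α (t : V) = v ∧ ∀ w, φ (α w) = φ w + (φ (v : V) - φ (t : V))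
  /-- the CENTRAL INVERSION of the relative chart at each base vertex, preserving `S` -/
  neg : ∀ t ∈ T, ∃ α : G ≃g G, (∀ w, w ∈ S ↔ α w ∈ S) ∧ α (t : V) = t ∧ ∀ w, φ (α w) - φ (t : V) = -(φ w - φ (t : V))
  /-- unit chart STEPS inside `S` -/
  step : ∀ (v : S) (i : Fin 2) (σ : ℤˣ), ∃ v' : S, G.Adj (v : V) v' ∧ φ (v' : V) = φ (v : V) + Pi.single i (σ : ℤ)
  /-- the relative cylinders at base vertices are CONNECTED -/
  cyl_connected : ∀ t ∈ T, ∀ ℓ : ℕ, 1 ≤ ℓ → (G.induce (relCyl φ S (t : V) ℓ)).Connected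

namespace InducedNegData

variable {V : Type} {G : SimpleGraph V} [G.LocallyFinite] {S : Set V} (D : InducedNegData G S)

/-- The cylinder of the induced skeleton about `t` is the relative cylinder, read in `V`. [folklore] -/
def relCylIso (t : S) (ℓ : ℕ) :
    (G.induce S).induce {w : S | D.φ (w : V) - D.φ (t : V) ∈ (box 2 ℓ : Finset (Site 2))} ≃g G.induce (relCyl D.φ S (t : V) ℓ) :=
  induceInduceIso G S _ _ (fun _ hv => hv.1) (fun _ hv => hv.2) (fun w hw => ⟨w.2, hw⟩)

/-- **THE INDUCED `{±1}` SKELETON: ambient `{±1}` data make `G[S]` a `PlanarSkeletonNeg` graph over the restricted chart.**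
[cite: KozmaNitzan2024, §4 pp. 15–17 (Lemma 8)] -/
def skeleton : PlanarSkeletonNeg (G.induce S) where
  φ := fun w => D.φ (w : V)
  lip := fun _ _ huv i => D.lip huv i
  types := D.T
  frame := fun v => by
    obtain ⟨t, ht, α, hS, hαt, hφ⟩ := D.frame v
    refine ⟨t, ht, isoInduceTo α S S hS, Subtype.ext (by rw [isoInduceTo_apply_coe, hαt]), fun w => ?_⟩
    show D.φ (α w) = D.φ (w : V) + (D.φ (v : V) - D.φ (t : V))
    exact hφ w
  neg := fun t ht => by
    obtain ⟨α, hS, hαt, hφ⟩ := D.neg t ht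
    refine ⟨isoInduceTo α S S hS, Subtype.ext (by rw [isoInduceTo_apply_coe, hαt]), fun w => ?_⟩
    show D.φ (α w) - D.φ (t : V) = -(D.φ (w : V) - D.φ (t : V))
    exact hφ w
  Δ := D.Δ
  degree_le := fun v => (degree_induce_le G S v).trans (D.degree_le v)
  step := fun v i σ => by
    obtain ⟨v', hadj, hφ⟩ := D.step v i σ
    exact ⟨v', hadj, hφ⟩
  cyl_connected := fun t ht ℓ hℓ =>
    (D.cyl_connected t ht ℓ hℓ).map (D.relCylIso t ℓ).symm.toHom (D.relCylIso t ℓ).symm.surjective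

/-- **`θ = 0` at the own critical point of `G[S]`, at every vertex of `S`, MODULO the open multi-type `{±1}` node u2** (Φ2-free form of the node's
customer row, `PlanarSkeletonNeg.criticalContinuity_of_negNode`).  Nothing is claimed about the node. [cite: BenjaminiSchramm1996, Conj. 4] -/
theorem criticalContinuity_of_negNode (D : InducedNegData G S) (hD : SamePDropOfSkeletonNeg) (v : S) :
    theta (G.induce S) v (criticalProbIOf (G.induce S) v) = 0 :=
  PlanarSkeletonNeg.criticalContinuity_of_negNode hD D.skeleton v

end InducedNegData

/-! ## §2 Pyrochlore-bond: the two-type `{±1}` skeleton on its site graph -/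

namespace PyroZ3

/-- The two base vertices as elements of the site set. [folklore] -/
def baseSite (c : Fin 2) : sites := ⟨base₂ c, base₂_mem_sites c⟩

/-- **Pyrochlore-bond's ambient `{±1}` data** for the unrotated unit chart: `uchart`, `ulip`, degree `≤ 12`, base vertices `(0,0,0)`, `(1,0,1)`,
frames from `exists_frame₂` (fcc translations and the z-glide), inversions from `exists_uneg_site`, steps from `ustep`, (κ) from `ucyl_connected`.
[cite: KozmaNitzan2024, §4 pp. 15–17 (Lemma 8)] [cite: ConwaySloane1999, Ch. 4 §6.1] -/
def negData : InducedNegData graph sites where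
  φ := uchart
  lip := fun _ _ h i => ulip h i
  Δ := 12
  degree_le := degree_le_twelve
  T := Finset.univ.image baseSite
  frame := fun v => by
    obtain ⟨c, α, hS, hαv, hφ⟩ := exists_frame₂ (v : Site 3) v.2
    exact ⟨baseSite c, Finset.mem_image_of_mem _ (Finset.mem_univ c), α, hS, hαv, hφ⟩
  neg := fun t ht => by
    obtain ⟨α, hS, hαt, hφ⟩ := exists_uneg_site (t : Site 3) t.2
    exact ⟨α, hS, hαt, hφ⟩
  step := fun v i σ => by
    obtain ⟨y, hadj, hφ⟩ := ustep (v : Site 3) v.2 i σ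
    exact ⟨⟨y, ((adj_iff _ _).1 hadj).2.1⟩, hadj, hφ⟩
  cyl_connected := fun t ht ℓ hℓ => by
    obtain ⟨c, -, rfl⟩ := Finset.mem_image.1 ht
    exact ucyl_connected c ℓ hℓ

/-- The base set of the pyrochlore data has exactly TWO elements. [folklore] -/
theorem negData_T_card : negData.T.card = 2 := by
  show (Finset.univ.image baseSite).card = 2
  rw [Finset.card_image_of_injective _ (fun c c' h => ?_), Finset.card_univ, Fintype.card_fin]
  have h' := congrArg (fun x : sites => (x : Site 3) 0) h
  fin_cases c <;> fin_cases c' <;> first | rfl | (exfalso; revert h'; decide)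

/-- **PYROCHLORE-BOND IS A TWO-TYPE `{±1}` CARRIER (typed): `PlanarSkeletonNeg` on its site graph, two base vertices.**
[cite: KozmaNitzan2024, §4 pp. 15–17 (Lemma 8)] -/
def skeletonNeg₂ : PlanarSkeletonNeg (graph.induce sites) := negData.skeleton

/-- The two types of the pyrochlore skeleton. [folklore] -/
theorem skeletonNeg₂_types_card : skeletonNeg₂.types.card = 2 := negData_T_card

/-- **CONDITIONAL CONTINUITY FOR PYROCHLORE-BOND: modulo the OPEN multi-type `{±1}` node u2, `θ_v(p_c) = 0` at every vertex of the pyrochlore site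
graph (bond percolation on the pyrochlore net = site-adjacency graph of the bonds of diamond).**  Nothing is claimed about the node.
[cite: BenjaminiSchramm1996, Conj. 4] -/
theorem criticalContinuity_of_negNode (hD : SamePDropOfSkeletonNeg) (v : sites) :
    theta (graph.induce sites) v (criticalProbIOf (graph.induce sites) v) = 0 :=
  negData.criticalContinuity_of_negNode hD v

end PyroZ3

end Summit.CriticalPhenomena.PercolationContinuityZ3.Theorems.Transplant

end
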